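import Summits.QuantumAdvantage.QuantumAdvantage.Theorems.InnerDegreeLawsH

set_option linter.dupNamespace false

/-!
# InnerDegreeLawsJ (lens 4, g27; part J = LAND-PACKAGE-7) — ONE-SIDED SATURATION: the rows are free (any injective family of affine row points with non-constant row tables against a full column flat has rank ≥ its size; cube rows qualify), and the column-saturated rectangle kill — the (c0) criterion needs a flat on the column side only, which places the dense register in the Erdős–Rényi regime

Blocker `X = AbsorptionDial.NoPerfectPolyOdd` (item 28487); decomp-qadv lens 4 (minimal-counterexample / extremal reduction), g27.  The NODE record
(rung `QuadFormNoPerfectOdd`, residual `QuadLiftOdd`, sub-rung `OneQuadNoPerfectOdd`, floor `linFormFloor`, `x_iff_pieces`) lives in the cell file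
`g27/InnerDegreeDial.lean` and is NOT landed (Prop-definition node pieces); the tree parts are Prop-definition-free and state only unconditional LAWS.
Parts A–I are LANDED (p825604/p825613/p825616/p825666/p826280/p826399/p826805/p827092/p827532; LAW C/Q/E/S/C⁺, first-moment subcubes, deletion
identity, normal form, LAW R, MOD_p / affine rectangle kills, saturated regime, its symmetry group, row tables); part J is the LAND-PACKAGE-7 delta (imports
part H only; independent of part I).  Kernel-checked content:

* §17 **one-sided saturation** (NODE9): the rows are free — for ANY injective family of affine row points `(1,a_i)` with non-constant
  row tables and ALL columns `w ∈ 𝔽_p^{r+1}` (or a full flat), `rank [f_i(⟨(1,a_i),w⟩)] ≥ |ι|` (`rank_famPat_ge`, `rank_famPat_flat_ge`;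
  cube rows `(1,1_S)` qualify, `indVec_injective`); game corollary `loss_of_columnSaturatedRectangle`: with an unbalanced cut
  (`O(log n + k log p)` cube rows against the rest) only the COLUMN half must saturate, which puts (c0) in the Erdős–Rényi regime and
  reduces it to surjectivity of the labelled quadratic subset-sum map of the column half (paper (x)).
-/

open Finset
open Summit.QuantumAdvantage.AdviceFreeQNC0

namespace Summit.QuantumAdvantage.QuantumAdvantage.Theorems.InnerDegreeDial

/-! ### §17 ONE-SIDED SATURATION (NODE9 §3 (c0)(x)): only the COLUMN side needs a flat — the rows are free

The diagonal-submatrix argument of §14/§16 uses ONE property of the rows: the affine points `(1, a_i)` of an injective family are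
pairwise non-proportional (their punctured frequency lines `{s•(1,a_i) : s ≠ 0}` are disjoint).  So for ANY injective row family
`a : ι → 𝔽_p^r` with row-dependent non-constant tables `f_i`, against ALL columns `w ∈ 𝔽_p^{r+1}` (or a full flat `N w + w₀`), the pattern
`[f_i(⟨(1,a_i), w⟩)]_{i,w}` has rank `≥ |ι|` (`rank_famPat_ge`, `rank_famPat_flat_ge`).  The rows need NO additive structure: the cube
points `(1, 1_S)`, `S ⊆ U`, qualify (`indVec_injective`) although a cube contains no line.  Game corollary
`loss_of_columnSaturatedRectangle`: registers `k`-form except `g₀`; rows any family, columns indexed by all of `𝔽_p^{r+1}`, `g₀` live and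
firing as `G_i(⟨(1,a_i), N w + w₀⟩)`; `|ι| > (n+1)·2p^k + 1` ⇒ loss.  CONSEQUENCE (paper (x)): the Σ-set criterion needs a flat on ONE side
only.  With an UNBALANCED cut — `|U| = m = O(log n + k·log p)` cube rows against the `n − m` remaining coordinates as columns — the column
half is deep inside the Erdős–Rényi regime, and (c0) reduces to COLUMN SATURATION: surjectivity, on a fibre of the additive labels, of the
labelled quadratic subset-sum map `T ↦ (Q_{U U′} 1_T, q_{U′}(T), μ(T), β(T))` of the column half.  Generic dense registers saturate
(equidistribution); the non-saturating ones found so far are exactly the dead classes (low rank, forms + sparse). -/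

section ColumnSaturated

variable {K : Type*} [Field K] [CharP K 2]
variable {p : ℕ} [Fact p.Prime]

/-- line-block matrix of a ROW FAMILY `i ↦ (1, a_i)` with row tables `f_i`: `M[i,u] = Σ_{s : s•(1,a_i) = u} f̂_i(s)` -/
noncomputable def famMat {ω : K} (hω : IsPrimitiveRoot ω p) {r : ℕ} {ι : Type*} (a : ι → Fin r → ZMod p)
    (f : ι → ZMod p → K) : Matrix ι (Fin (r + 1) → ZMod p) K :=
  Matrix.of fun i u => ∑ s : ZMod p, if s • lineRep p r (a i) = u then fcoef hω (f i) s else 0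

/-- pattern of a row family against ALL columns: `[f_i(⟨(1,a_i), w⟩)]_{i ∈ ι, w ∈ 𝔽_p^{r+1}}` -/
def famPat {r : ℕ} {ι : Type*} (a : ι → Fin r → ZMod p) (f : ι → ZMod p → K) : Matrix ι (Fin (r + 1) → ZMod p) K :=
  Matrix.of fun i w => f i (lineRep p r (a i) ⬝ᵥ w)

/-- `P = M · F` for a row family (Fourier inversion row by row) -/
theorem famMat_mul_charMat (hp5 : 5 ≤ p) {ω : K} (hω : IsPrimitiveRoot ω p) {r : ℕ} {ι : Type*}
    (a : ι → Fin r → ZMod p) (f : ι → ZMod p → K) : famMat hω a f * charMat hω (r + 1) = famPat a f := by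
  classical
  ext i w
  rw [Matrix.mul_apply, famPat, Matrix.of_apply]
  have h1 : ∀ u, famMat hω a f i u * charMat hω (r + 1) u w
      = ∑ s, if s • lineRep p r (a i) = u then fcoef hω (f i) s * Coset21.CharTwoKill.chi ω hω (u ⬝ᵥ w) else 0 := by
    intro u
    rw [famMat, Matrix.of_apply, charMat, Matrix.of_apply, sum_mul]
    refine sum_congr rfl fun s _ => ?_
    split_ifs
    · rfl
    · rw [zero_mul]
  simp_rw [h1]
  rw [sum_comm]
  have h2 : ∀ s : ZMod p, ∑ u : Fin (r + 1) → ZMod p,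
      (if s • lineRep p r (a i) = u then fcoef hω (f i) s * Coset21.CharTwoKill.chi ω hω (u ⬝ᵥ w) else 0)
      = fcoef hω (f i) s * Coset21.CharTwoKill.chi ω hω (s * (lineRep p r (a i) ⬝ᵥ w)) := by
    intro s
    rw [sum_ite_eq]
    simp only [mem_univ, if_true, smul_dotProduct, smul_eq_mul]
  simp_rw [h2]
  exact fourier_inv hp5 hω (f i) (lineRep p r (a i) ⬝ᵥ w)

omit [CharP K 2] in
/-- rows `i`, columns `s(i) • (1, a_i)` with one nonzero frequency per row: the family line-block matrix is diagonal, because the affine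
points `(1, a_i)` of an injective family are pairwise non-proportional — the ONLY property of the rows the argument uses -/
theorem famMat_submatrix {ω : K} (hω : IsPrimitiveRoot ω p) {r : ℕ} {ι : Type*} [DecidableEq ι] (a : ι → Fin r → ZMod p)
    (ha : Function.Injective a) (f : ι → ZMod p → K) (s : ι → ZMod p) (hs : ∀ i, s i ≠ 0) :
    (famMat hω a f).submatrix (fun i => i) (fun i => s i • lineRep p r (a i))
      = Matrix.diagonal fun i => fcoef hω (f i) (s i) := by
  classical
  ext i i'
  rw [Matrix.submatrix_apply, famMat, Matrix.of_apply, Matrix.diagonal_apply, sum_eq_single (s i')]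
  · by_cases h : i = i'
    · subst h; simp
    · rw [if_neg h, if_neg]
      intro heq
      apply h
      have hinj : lineRep p r (a i) = lineRep p r (a i') := smul_right_injective _ (hs i') heq
      apply ha
      funext j
      have := congrFun hinj j.succ
      simpa [lineRep] using this
  · intro s' _ hs'
    rw [if_neg]
    intro heq
    apply hs'
    have := congrFun heq 0
    simpa [lineRep] using this
  · intro h
    exact absurd (mem_univ _) h

/-- **ONE-SIDED SATURATION (§17).**  Rows: ANY injective family of affine points `(1, a_i)`, `a : ι → 𝔽_p^r` injective, with
row-dependent non-constant tables `f_i`; columns: ALL of `𝔽_p^{r+1}`.  Then `[f_i(⟨(1,a_i), w⟩)]_{i,w}` has rank `≥ |ι|`.  The rows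
need NO additive structure (e.g. the cube points `(1, 1_S)`, `S ⊆ U`, although a cube contains no line): only the column side must be
a flat. -/
theorem rank_famPat_ge (hp5 : 5 ≤ p) {ω : K} (hω : IsPrimitiveRoot ω p) {r : ℕ} {ι : Type*} [Fintype ι]
    (a : ι → Fin r → ZMod p) (ha : Function.Injective a) (f : ι → ZMod p → K) (hf : ∀ i, ∃ x x', f i x ≠ f i x') :
    Fintype.card ι ≤ (famPat a f).rank := by
  classical
  have hch : ∀ i, ∃ s₀ : ZMod p, s₀ ≠ 0 ∧ fcoef hω (f i) s₀ ≠ 0 := fun i => by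
    obtain ⟨x, x', hxx'⟩ := hf i
    exact exists_fcoef_ne_zero hp5 hω _ hxx'
  choose s hs0 hsc using hch
  rw [← famMat_mul_charMat hp5 hω a f,
    Matrix.rank_mul_eq_left_of_isUnit_det _ _ (isUnit_charMat_det hp5 hω (r + 1))]
  refine le_trans ?_ (Matrix.rank_submatrix_le (famMat hω a f) (fun i => i) (fun i => s i • lineRep p r (a i)))
  rw [famMat_submatrix hω a ha f s hs0]
  have hu : IsUnit (Matrix.diagonal fun i => fcoef hω (f i) (s i)) := by
    rw [Matrix.isUnit_iff_isUnit_det, Matrix.det_diagonal]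
    exact isUnit_iff_ne_zero.mpr (prod_ne_zero_iff.mpr fun i _ => hsc i)
  rw [Matrix.rank_of_isUnit _ hu]

/-- the same against a full column FLAT `w ↦ N w + w₀` read through `⟨(1,a_i), ·⟩` with `N` left-invertible on the pairing side
(`N' * N = 1`): reindex the columns by `N'` -/
theorem rank_famPat_flat_ge (hp5 : 5 ≤ p) {ω : K} (hω : IsPrimitiveRoot ω p) {r : ℕ} {ι : Type*} [Fintype ι]
    (a : ι → Fin r → ZMod p) (ha : Function.Injective a) (f : ι → ZMod p → K) (hf : ∀ i, ∃ x x', f i x ≠ f i x')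
    (w₀ : Fin (r + 1) → ZMod p) (N N' : Matrix (Fin (r + 1)) (Fin (r + 1)) (ZMod p)) (hN : N * N' = 1) :
    Fintype.card ι ≤ (Matrix.of fun i (w : Fin (r + 1) → ZMod p) => f i (lineRep p r (a i) ⬝ᵥ (N.mulVec w + w₀))).rank := by
  classical
  have hsub : (Matrix.of fun i (w : Fin (r + 1) → ZMod p) => f i (lineRep p r (a i) ⬝ᵥ (N.mulVec w + w₀))).submatrix
      (fun i => i) (fun w => N'.mulVec (w - w₀))
      = famPat a f := by
    ext i w
    rw [Matrix.submatrix_apply, Matrix.of_apply, famPat, Matrix.of_apply, Matrix.mulVec_mulVec, hN,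
      Matrix.one_mulVec, sub_add_cancel]
  have h1 := rank_famPat_ge hp5 hω a ha f hf
  rw [← hsub] at h1
  exact h1.trans (Matrix.rank_submatrix_le _ _ _)

variable {n : ℕ}

/-- **THE COLUMN-SATURATED RECTANGLE KILL (§17; one-sided).**  Registers `k`-form except `g₀`; rows ANY family `X i`, `i : ι`, columns `Y w`
indexed by ALL `w ∈ 𝔽_p^{r+1}` (a column family whose labelled cross-sums fill a full `(r+1)`-flat), disjoint supports, `g₀` live on the
rectangle and firing as `G_i(⟨(1,a_i), N w + w₀⟩)` for an injective `a : ι → 𝔽_p^r` and ROW-DEPENDENT non-constant tables `G_i`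
(absorbing every row-side label); `|ι| > (n+1)·2p^k + 1` forces a losing input.  The rows need no additive structure: with an
unbalanced cut the cube rows `(1, 1_S)`, `S ⊆ U`, `|U| = O(log n + k·log p)`, suffice, and only the COLUMN half must saturate. -/
theorem loss_of_columnSaturatedRectangle (hp5 : 5 ≤ p) {k r : ℕ} {ι : Type*} [Fintype ι] (c : ℕ)
    (y : Fin (n + 1) → (Fin n → Bool) → Bool) (g₀ : Fin (n + 1))
    (lam : Fin (n + 1) → Fin k → Fin n → ZMod p) (F : Fin (n + 1) → (Fin k → ZMod p) → Bool)
    (hF : ∀ g, g ≠ g₀ → ∀ u, y g u = F g (fun j => ∑ i, if u i = true then lam g j i else 0))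
    (X : ι → Fin n → Bool) (Y : (Fin (r + 1) → ZMod p) → Fin n → Bool) (hd : ∀ i w l, ¬ (X i l = true ∧ Y w l = true))
    (G : ι → ZMod p → Bool) (hG : ∀ i, ∃ b₁ b₂, G i b₁ ≠ G i b₂)
    (a : ι → Fin r → ZMod p) (ha : Function.Injective a)
    (w₀ : Fin (r + 1) → ZMod p) (N N' : Matrix (Fin (r + 1)) (Fin (r + 1)) (ZMod p)) (hN : N * N' = 1)
    (hpat : ∀ i w, y g₀ (bor (X i) (Y w)) = G i (lineRep p r (a i) ⬝ᵥ (N.mulVec w + w₀)))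
    (hlive : ∀ i w, liveCut c (bor (X i) (Y w)) g₀ = true)
    (ht : (n + 1) * (p ^ k * 2) + 1 < Fintype.card ι) :
    ∃ u, ringWinU c y u = false := by
  classical
  obtain ⟨hK, ω, -, hω, -⟩ := Coset21.exists_charTwo_roots p hp5
  haveI := hK
  refine loss_of_rectRank hp5 c y g₀ lam F hF X Y hd (lt_of_lt_of_le ht ?_)
  have hrect : rect (Kp p) (fun u => y g₀ u && liveCut c u g₀) X Y
      = Matrix.of fun i (w : Fin (r + 1) → ZMod p) =>
          (fun i t => if G i t = true then (1 : Kp p) else 0) i (lineRep p r (a i) ⬝ᵥ (N.mulVec w + w₀)) := by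
    ext i w
    rw [rect, Matrix.of_apply, Matrix.of_apply]
    simp only [hpat i w, hlive i w, Bool.and_true]
  rw [hrect]
  refine rank_famPat_flat_ge hp5 hω a ha (fun i t => if G i t = true then (1 : Kp p) else 0) ?_ w₀ N N' hN
  intro i
  obtain ⟨b₁, b₂, hb⟩ := hG i
  refine ⟨b₁, b₂, ?_⟩
  intro h
  apply hb
  cases h1 : G i b₁ <;> cases h2 : G i b₂ <;> simp_all

/-- cube rows qualify: `S ↦ 1_S ∈ 𝔽_p^m` is injective on `S : Fin m → Bool` -/
theorem indVec_injective (m : ℕ) :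
    Function.Injective (fun (S : Fin m → Bool) (j : Fin m) => (if S j = true then (1 : ZMod p) else 0)) := by
  intro S S' h
  funext j
  have hj := congrFun h j
  have hp1 : (1 : ZMod p) ≠ 0 := one_ne_zero
  by_cases h1 : S j = true <;> by_cases h2 : S' j = true <;> simp_all

end ColumnSaturated

end Summit.QuantumAdvantage.QuantumAdvantage.Theorems.InnerDegreeDial
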